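import Literature.NumberTheory.Transcendental.KZLogCalculusProofs
import Literature.NumberTheory.Transcendental.KZProductIdeal
import Mathlib.Analysis.Analytic.Constructions
import Mathlib.Analysis.Analytic.Linear

/-!
# `SectorToKernel` (stmt-KontsevichZagierPeriods-10813), line `effective-cube-surjection`, stub F:
# the straightening step

Helper file for the lead's stub `stub_nashCellReductionOf` (skeleton v6).  One step of the recursion
that straightens an open bounded cell of a Nash cylindrical decomposition onto the open cube by
Kontsevich–Zagier moves: if `S' ⊆ ℝⁿ` is open and *straightenable* (every representation on
`(0,1)^{q+1} × S'` with analytic integrand is congruent modulo relations to a `ℤ`-combination of open-cube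
classes `[(0,1)^{q+1+n}, J]`, `J` analytic), then so is every inner band `T` over `S'` with analytic
`ℚ`-semialgebraic walls `ξ⁻ < ξ⁺` (at level `q`): the domain `(0,1)^q × T ⊆ ℝ^{(q+n)+1}` is the open band over
`(0,1)^q × S'` with walls `ξ^∓`; straighten its last coordinate by the affine move (stub B, taken as a
hypothesis), move that coordinate to the front by a coordinate permutation
(`KZ.of_sub_of_reindex_mem_relations`), apply straightenability of `S'` at level `q + 1`, and transport the
resulting combination back along `Fin (q+1+n) ≃ Fin (q+n+1)`.
-/

noncomputable section

namespace Summit.KontsevichZagierPeriods.FurushoPentagon.SectorToKernel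

open Set MeasureTheory
open Literature.ModelTheory.ExponentialFields
open Literature.NumberTheory.Transcendental
open Literature.NumberTheory.Transcendental.KZ

/-! ## Coordinate bookkeeping -/

/-- The coordinate permutation moving the last coordinate of `ℝ^{(q+n)+1}` to position `q` (in front of the
block of the last `n` coordinates), as an equivalence of index types `Fin (q+n+1) ≃ Fin (q+1+n)` with its
three defining equations. [folklore] -/
theorem exists_frontRotate (q n : ℕ) : ∃ e : Fin (q + n + 1) ≃ Fin (q + 1 + n),
    (∀ i : Fin q, e (Fin.castSucc (Fin.castAdd n i)) = Fin.castAdd n (Fin.castSucc i)) ∧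
    e (Fin.last (q + n)) = Fin.castAdd n (Fin.last q) ∧
    ∀ j : Fin n, e (Fin.castSucc (Fin.natAdd q j)) = Fin.natAdd (q + 1) j := by
  refine ⟨⟨fun v => ⟨if (v : ℕ) < q then (v : ℕ) else if (v : ℕ) = q + n then q else (v : ℕ) + 1, by
        split_ifs <;> omega⟩,
      fun w => ⟨if (w : ℕ) < q then (w : ℕ) else if (w : ℕ) = q then q + n else (w : ℕ) - 1, by
        split_ifs <;> omega⟩, fun v => ?_, fun w => ?_⟩, fun i => ?_, ?_, fun j => ?_⟩
  · apply Fin.ext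
    dsimp only
    split_ifs <;> omega
  · apply Fin.ext
    dsimp only
    split_ifs <;> omega
  · apply Fin.ext
    simp only [Equiv.coe_fn_mk, Fin.val_mk, Fin.val_castSucc, Fin.val_castAdd]
    split_ifs <;> omega
  · apply Fin.ext
    simp only [Equiv.coe_fn_mk, Fin.val_mk, Fin.val_last, Fin.val_castAdd]
    split_ifs <;> omega
  · apply Fin.ext
    simp only [Equiv.coe_fn_mk, Fin.val_mk, Fin.val_castSucc, Fin.val_natAdd]
    split_ifs <;> omega

/-- The open unit cube of `ℝᵈ`, written as in the registered stubs. [folklore] -/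
theorem mem_openCube_iff {d : ℕ} (x : Fin d → ℝ) :
    x ∈ {x : Fin d → ℝ | ∀ i, 0 < x i ∧ x i < 1} ↔ ∀ i, 0 < x i ∧ x i < 1 := Iff.rfl

/-! ## Transport of open-cube Nash combinations along a relabelling of coordinates -/

/-- Relabelling the coordinates of an open-cube Nash class gives an open-cube Nash class. [folklore] -/
theorem reindex_mem_gens {a b : ℕ} (e : Fin a ≃ Fin b) (v : IntegralRep a)
    (hvd : v.domain = {x : Fin a → ℝ | ∀ i, 0 < x i ∧ x i < 1})
    (hva : AnalyticOnNhd ℝ v.integrand {x : Fin a → ℝ | ∀ i, 0 < x i ∧ x i < 1}) :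
    (v.reindex e).domain = {x : Fin b → ℝ | ∀ i, 0 < x i ∧ x i < 1} ∧
      AnalyticOnNhd ℝ (v.reindex e).integrand {x : Fin b → ℝ | ∀ i, 0 < x i ∧ x i < 1} := by
  have hdom : (v.reindex e).domain = {x : Fin b → ℝ | ∀ i, 0 < x i ∧ x i < 1} := by
    ext w
    simp only [IntegralRep.reindex_domain, hvd, mem_setOf_eq]
    constructor
    · intro h i
      simpa using h (e.symm i)
    · intro h i
      exact h (e i)
  refine ⟨hdom, ?_⟩
  intro w hw
  rw [IntegralRep.reindex_integrand]
  set L : (Fin b → ℝ) →L[ℝ] (Fin a → ℝ) := ContinuousLinearMap.pi fun i => ContinuousLinearMap.proj (e i)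
  have hL : ∀ w : Fin b → ℝ, L w = fun i => w (e i) := fun w => rfl
  have hmem : (fun i => w (e i)) ∈ {x : Fin a → ℝ | ∀ i, 0 < x i ∧ x i < 1} := fun i => hw (e i)
  have h := (hva _ hmem).comp (L.analyticAt w)
  exact h

/-- **Transport of the open-cube Nash span along `Fin a ≃ Fin b`**: every element of the span in dimension
`a` is congruent modulo relations to an element of the span in dimension `b` (generator by generator,
`KZ.of_sub_of_reindex_mem_relations`). [cite: KontsevichZagier2001, §1.2 rule (2)] -/
theorem span_transport {a b : ℕ} (e : Fin a ≃ Fin b) :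
    ∀ c ∈ AddSubgroup.closure {d : FormalRep | ∃ v : IntegralRep a,
        v.domain = {x : Fin a → ℝ | ∀ i, 0 < x i ∧ x i < 1} ∧
        AnalyticOnNhd ℝ v.integrand {x : Fin a → ℝ | ∀ i, 0 < x i ∧ x i < 1} ∧ d = of v},
      ∃ c' ∈ AddSubgroup.closure {d : FormalRep | ∃ v : IntegralRep b,
        v.domain = {x : Fin b → ℝ | ∀ i, 0 < x i ∧ x i < 1} ∧
        AnalyticOnNhd ℝ v.integrand {x : Fin b → ℝ | ∀ i, 0 < x i ∧ x i < 1} ∧ d = of v},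
      c - c' ∈ relations := by
  intro c hc
  induction hc using AddSubgroup.closure_induction with
  | mem x hx =>
    obtain ⟨v, hvd, hva, rfl⟩ := hx
    obtain ⟨h1, h2⟩ := reindex_mem_gens e v hvd hva
    exact ⟨of (v.reindex e), AddSubgroup.subset_closure ⟨v.reindex e, h1, h2, rfl⟩,
      of_sub_of_reindex_mem_relations v e⟩
  | zero => exact ⟨0, AddSubgroup.zero_mem _, by simp⟩
  | add x y _ _ hx hy =>
    obtain ⟨a', ha', hxa⟩ := hx
    obtain ⟨b', hb', hyb⟩ := hy
    refine ⟨a' + b', AddSubgroup.add_mem _ ha' hb', ?_⟩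
    have : x + y - (a' + b') = (x - a') + (y - b') := by abel
    rw [this]
    exact relations.add_mem hxa hyb
  | neg x _ hx =>
    obtain ⟨a', ha', hxa⟩ := hx
    refine ⟨-a', AddSubgroup.neg_mem _ ha', ?_⟩
    have : -x - -a' = -(x - a') := by abel
    rw [this]
    exact relations.neg_mem hxa

/-! ## The passive/active coordinate blocks -/

/-- The block `(0,1)^q × S ⊆ ℝ^{q+n}` (first `q` coordinates in the open unit interval, last `n` in `S`) is
`ℚ`-semialgebraic when `S` is. [folklore] -/
theorem isSemialgebraic_block {q n : ℕ} {S : Set (Fin n → ℝ)} (hS : IsSemialgebraic ℚ S) :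
    IsSemialgebraic ℚ {w : Fin (q + n) → ℝ | (∀ i : Fin q, 0 < w (Fin.castAdd n i) ∧ w (Fin.castAdd n i) < 1) ∧
      (fun j => w (Fin.natAdd q j)) ∈ S} := by
  classical
  have h1 : IsSemialgebraic ℚ (⋂ i ∈ (Finset.univ : Finset (Fin q)),
      ({w : Fin (q + n) → ℝ | 0 < w (Fin.castAdd n i)} ∩ {w | w (Fin.castAdd n i) < 1})) := by
    refine IsSemialgebraic.biInter _ _ fun i _ => IsSemialgebraic.inter ?_ ?_
    · have h := isSemialgebraic_setOf_eval_pos (k := ℚ) (R := ℝ)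
        (MvPolynomial.X (Fin.castAdd n i) : MvPolynomial (Fin (q + n)) ℚ)
      simpa only [MvPolynomial.aeval_X] using h
    · have h := isSemialgebraic_setOf_eval_lt (k := ℚ) (R := ℝ)
        (MvPolynomial.X (Fin.castAdd n i) : MvPolynomial (Fin (q + n)) ℚ) (MvPolynomial.C 1)
      simpa only [MvPolynomial.aeval_X, MvPolynomial.aeval_C, map_one] using h
  have h2 : IsSemialgebraic ℚ {w : Fin (q + n) → ℝ | (fun j => w (Fin.natAdd q j)) ∈ S} :=
    hS.preimage_comp (Fin.natAdd q)
  convert h1.inter h2 using 1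
  ext w
  simp only [mem_setOf_eq, mem_inter_iff, mem_iInter, Finset.mem_univ, forall_const]

/-- The block `(0,1)^q × S` is open when `S` is. [folklore] -/
theorem isOpen_block {q n : ℕ} {S : Set (Fin n → ℝ)} (hS : IsOpen S) :
    IsOpen {w : Fin (q + n) → ℝ | (∀ i : Fin q, 0 < w (Fin.castAdd n i) ∧ w (Fin.castAdd n i) < 1) ∧
      (fun j => w (Fin.natAdd q j)) ∈ S} := by
  have h1 : IsOpen (⋂ i : Fin q, ({w : Fin (q + n) → ℝ | 0 < w (Fin.castAdd n i)} ∩ {w | w (Fin.castAdd n i) < 1})) :=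
    isOpen_iInter_of_finite fun i => (isOpen_lt continuous_const (continuous_apply _)).inter
      (isOpen_lt (continuous_apply _) continuous_const)
  have h2 : IsOpen {w : Fin (q + n) → ℝ | (fun j => w (Fin.natAdd q j)) ∈ S} :=
    hS.preimage (continuous_pi fun j => continuous_apply _)
  convert h1.inter h2 using 1
  ext w
  simp only [mem_setOf_eq, mem_inter_iff, mem_iInter]

/-! ## The straightening step -/

/-- **The straightening step.**  Let `S' ⊆ ℝⁿ` be open and `ℚ`-semialgebraic, `lo < hi` real analytic and
`ℚ`-semialgebraic on `S'`, and assume (stub B) that affine straightening of open bands is a move and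
(induction hypothesis) that `S'` is straightenable at level `q + 1`.  Then the inner band
`T = {w | init w ∈ S', lo (init w) < w last < hi (init w)}` is straightenable at level `q`: every representation
on `(0,1)^q × T` with analytic integrand is congruent modulo relations to a `ℤ`-combination of open-cube Nash
classes of dimension `q + (n + 1)`. [cite: BochnakCosteRoy1998, Prop. 2.9.10] [cite: KontsevichZagier2001, §1.2 rule (2)] -/
theorem straighten_step_of {q n : ℕ} {S' : Set (Fin n → ℝ)} (hS'o : IsOpen S') (hS's : IsSemialgebraic ℚ S')
    {lo hi : (Fin n → ℝ) → ℝ} (hlo_a : AnalyticOnNhd ℝ lo S') (hhi_a : AnalyticOnNhd ℝ hi S')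
    (hlo_s : IsSemialgebraicFunOn ℚ S' lo) (hhi_s : IsSemialgebraicFunOn ℚ S' hi)
    (hlt : ∀ x ∈ S', lo x < hi x)
    (hB : ∀ {M : ℕ} {G : Set (Fin M → ℝ)}, IsOpen G → IsSemialgebraic ℚ G →
      ∀ {α β : (Fin M → ℝ) → ℝ}, IsSemialgebraicFunOn ℚ G α → IsSemialgebraicFunOn ℚ G β →
      DifferentiableOn ℝ α G → DifferentiableOn ℝ β G → (∀ y ∈ G, 0 < β y) →
      ∀ r' : IntegralRep (M + 1),
        r'.domain = {z | (Fin.init z : Fin M → ℝ) ∈ G ∧ α (Fin.init z) < z (Fin.last M) ∧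
          z (Fin.last M) < α (Fin.init z) + β (Fin.init z)} →
        ∃ r : IntegralRep (M + 1),
          r.domain = {z | (Fin.init z : Fin M → ℝ) ∈ G ∧ 0 < z (Fin.last M) ∧ z (Fin.last M) < 1} ∧
          (r.integrand = fun z => r'.integrand (Fin.snoc (Fin.init z)
            (α (Fin.init z) + β (Fin.init z) * z (Fin.last M))) * β (Fin.init z)) ∧
          of r - of r' ∈ relations)
    (IH : ∀ r : IntegralRep (q + 1 + n),
      r.domain = {z | (∀ i : Fin (q + 1), 0 < z (Fin.castAdd n i) ∧ z (Fin.castAdd n i) < 1) ∧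
        (fun j => z (Fin.natAdd (q + 1) j)) ∈ S'} →
      AnalyticOnNhd ℝ r.integrand r.domain →
      ∃ c ∈ AddSubgroup.closure {d : FormalRep | ∃ v : IntegralRep (q + 1 + n),
          v.domain = {x : Fin (q + 1 + n) → ℝ | ∀ i, 0 < x i ∧ x i < 1} ∧
          AnalyticOnNhd ℝ v.integrand {x : Fin (q + 1 + n) → ℝ | ∀ i, 0 < x i ∧ x i < 1} ∧ d = of v},
        of r - c ∈ relations)
    (r : IntegralRep (q + (n + 1)))
    (hdom : r.domain = {z | (∀ i : Fin q, 0 < z (Fin.castAdd (n + 1) i) ∧ z (Fin.castAdd (n + 1) i) < 1) ∧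
      (fun j => z (Fin.natAdd q j)) ∈ {w : Fin (n + 1) → ℝ | (Fin.init w : Fin n → ℝ) ∈ S' ∧
        lo (Fin.init w) < w (Fin.last n) ∧ w (Fin.last n) < hi (Fin.init w)}})
    (han : AnalyticOnNhd ℝ r.integrand r.domain) :
    ∃ c ∈ AddSubgroup.closure {d : FormalRep | ∃ v : IntegralRep (q + (n + 1)),
        v.domain = {x : Fin (q + (n + 1)) → ℝ | ∀ i, 0 < x i ∧ x i < 1} ∧
        AnalyticOnNhd ℝ v.integrand {x : Fin (q + (n + 1)) → ℝ | ∀ i, 0 < x i ∧ x i < 1} ∧ d = of v},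
      of r - c ∈ relations := by
  -- the base block `G = (0,1)^q × S' ⊆ ℝ^{q+n}` and the walls read on it
  set G : Set (Fin (q + n) → ℝ) := {w | (∀ i : Fin q, 0 < w (Fin.castAdd n i) ∧ w (Fin.castAdd n i) < 1) ∧
    (fun j => w (Fin.natAdd q j)) ∈ S'} with hG
  set π : (Fin (q + n) → ℝ) →L[ℝ] (Fin n → ℝ) :=
    ContinuousLinearMap.pi fun j => ContinuousLinearMap.proj (Fin.natAdd q j) with hπ
  have hπa : ∀ w, π w = fun j => w (Fin.natAdd q j) := fun w => rfl
  obtain ⟨α, hα⟩ : ∃ α : (Fin (q + n) → ℝ) → ℝ, α = fun w => lo (π w) := ⟨_, rfl⟩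
  obtain ⟨β, hβ⟩ : ∃ β : (Fin (q + n) → ℝ) → ℝ, β = fun w => hi (π w) - lo (π w) := ⟨_, rfl⟩
  have hGo : IsOpen G := isOpen_block hS'o
  have hGs : IsSemialgebraic ℚ G := isSemialgebraic_block hS's
  have hπG : ∀ w ∈ G, π w ∈ S' := fun w hw => hw.2
  have hπs : IsSemialgebraicMapOn ℚ G π := by
    convert isSemialgebraicMapOn_aeval hGs (fun j => (MvPolynomial.X (Fin.natAdd q j) : MvPolynomial (Fin (q + n)) ℚ))
      using 2 with w
    ext j; simp [hπa]
  have hαs : IsSemialgebraicFunOn ℚ G α := by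
    rw [hα]; exact IsSemialgebraicFunOn.comp_isSemialgebraicMapOn_holds hlo_s hπs hπG
  have hβs : IsSemialgebraicFunOn ℚ G β := by
    rw [hβ]
    exact IsSemialgebraicFunOn.sub_holds (IsSemialgebraicFunOn.comp_isSemialgebraicMapOn_holds hhi_s hπs hπG)
      (IsSemialgebraicFunOn.comp_isSemialgebraicMapOn_holds hlo_s hπs hπG)
  have hαd : DifferentiableOn ℝ α G := by
    rw [hα]
    exact fun w hw => ((hlo_a _ (hπG w hw)).differentiableAt.comp w (π.differentiableAt)).differentiableWithinAt
  have hβd : DifferentiableOn ℝ β G := by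
    rw [hβ]
    exact fun w hw => (((hhi_a _ (hπG w hw)).differentiableAt.comp w (π.differentiableAt)).sub
      ((hlo_a _ (hπG w hw)).differentiableAt.comp w (π.differentiableAt))).differentiableWithinAt
  have hβpos : ∀ w ∈ G, 0 < β w := fun w hw => by rw [hβ]; exact sub_pos.2 (hlt _ (hπG w hw))
  -- coordinate identities between `ℝ^{q+(n+1)}` and `ℝ^{(q+n)+1}`
  have e1 : ∀ (z : Fin (q + n + 1) → ℝ) (i : Fin q), z (Fin.castAdd (n + 1) i) = Fin.init z (Fin.castAdd n i) :=
    fun z i => rfl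
  have e2 : ∀ (z : Fin (q + n + 1) → ℝ),
      (Fin.init (fun j : Fin (n + 1) => z (Fin.natAdd q j)) : Fin n → ℝ) = π (Fin.init z) := by
    intro z; ext j; rfl
  have e3 : ∀ (z : Fin (q + n + 1) → ℝ), (fun j : Fin (n + 1) => z (Fin.natAdd q j)) (Fin.last n) =
      z (Fin.last (q + n)) := fun z => rfl
  -- the domain of `r` is the open band over `G` with walls `α < α + β`
  have hdom' : r.domain = {z | (Fin.init z : Fin (q + n) → ℝ) ∈ G ∧ α (Fin.init z) < z (Fin.last (q + n)) ∧
      z (Fin.last (q + n)) < α (Fin.init z) + β (Fin.init z)} := by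
    rw [hdom]
    ext z
    simp only [mem_setOf_eq, hG, hα, hβ, e2, add_sub_cancel]
    constructor
    · rintro ⟨h1, h2, h3, h4⟩
      exact ⟨⟨fun i => h1 i, by simpa [hπa] using h2⟩, h3, h4⟩
    · rintro ⟨⟨h1, h2⟩, h3, h4⟩
      exact ⟨fun i => h1 i, by simpa [hπa] using h2, h3, h4⟩
  -- straighten the last coordinate (stub B)
  obtain ⟨r₁, hr₁d, hr₁i, hr₁⟩ := hB hGo hGs hαs hβs hαd hβd hβpos r hdom'
  -- analyticity of the pulled-back integrand
  have hr₁a : AnalyticOnNhd ℝ r₁.integrand r₁.domain := by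
    intro z hz
    rw [hr₁d] at hz
    obtain ⟨hzG, hz0, hz1⟩ := hz
    set πi : (Fin (q + n + 1) → ℝ) →L[ℝ] (Fin n → ℝ) :=
      ContinuousLinearMap.pi fun j => ContinuousLinearMap.proj (Fin.castSucc (Fin.natAdd q j)) with hπi
    have hπi' : ∀ w : Fin (q + n + 1) → ℝ, πi w = π (Fin.init w) := fun w => rfl
    have hαa : AnalyticAt ℝ (fun w : Fin (q + n + 1) → ℝ => α (Fin.init w)) z := by
      have h := (hlo_a _ (hπG _ hzG)).comp_of_eq (πi.analyticAt z) (hπi' z)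
      rw [hα]
      exact h
    have hβa : AnalyticAt ℝ (fun w : Fin (q + n + 1) → ℝ => β (Fin.init w)) z := by
      have h1 := (hhi_a _ (hπG _ hzG)).comp_of_eq (πi.analyticAt z) (hπi' z)
      have h2 := (hlo_a _ (hπG _ hzG)).comp_of_eq (πi.analyticAt z) (hπi' z)
      rw [hβ]
      exact h1.sub h2
    have hlast : AnalyticAt ℝ (fun w : Fin (q + n + 1) → ℝ => w (Fin.last (q + n))) z :=
      (ContinuousLinearMap.proj (R := ℝ) (Fin.last (q + n))).analyticAt z
    have hg : AnalyticAt ℝ (fun w : Fin (q + n + 1) → ℝ =>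
        α (Fin.init w) + β (Fin.init w) * w (Fin.last (q + n))) z := hαa.add (hβa.mul hlast)
    have hΦ : AnalyticAt ℝ (fun w : Fin (q + n + 1) → ℝ => (Fin.snoc (Fin.init w)
        (α (Fin.init w) + β (Fin.init w) * w (Fin.last (q + n))) : Fin (q + n + 1) → ℝ)) z := by
      refine AnalyticAt.pi fun k => ?_
      refine Fin.lastCases ?_ (fun i => ?_) k
      · simpa only [Fin.snoc_last] using hg
      · have : (fun w : Fin (q + n + 1) → ℝ => (Fin.snoc (Fin.init w)
            (α (Fin.init w) + β (Fin.init w) * w (Fin.last (q + n))) : Fin (q + n + 1) → ℝ) (Fin.castSucc i)) =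
            fun w => w (Fin.castSucc i) := by
          funext w; simp [Fin.snoc_castSucc, Fin.init]
        rw [this]
        exact (ContinuousLinearMap.proj (R := ℝ) (Fin.castSucc i)).analyticAt z
    have hmem : (Fin.snoc (Fin.init z) (α (Fin.init z) + β (Fin.init z) * z (Fin.last (q + n))) :
        Fin (q + n + 1) → ℝ) ∈ r.domain := by
      rw [hdom']
      have hb := hβpos _ hzG
      refine ⟨by simpa using hzG, ?_, ?_⟩
      · simp only [Fin.init_snoc, Fin.snoc_last]
        nlinarith
      · simp only [Fin.init_snoc, Fin.snoc_last]
        nlinarith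
    have hcomp := (han _ hmem).comp_of_eq hΦ rfl
    rw [hr₁i]
    exact hcomp.mul hβa
  -- move the straightened coordinate to the front
  obtain ⟨e, he1, he2, he3⟩ := exists_frontRotate q n
  set r₂ : IntegralRep (q + 1 + n) := r₁.reindex e with hr₂
  have hr₁₂ : of r₁ - of r₂ ∈ relations := of_sub_of_reindex_mem_relations r₁ e
  have hr₂d : r₂.domain = {z | (∀ i : Fin (q + 1), 0 < z (Fin.castAdd n i) ∧ z (Fin.castAdd n i) < 1) ∧
      (fun j => z (Fin.natAdd (q + 1) j)) ∈ S'} := by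
    rw [hr₂, IntegralRep.reindex_domain, hr₁d]
    ext w
    simp only [mem_setOf_eq, hG]
    have hi1 : ∀ i : Fin q, Fin.init (fun i => w (e i)) (Fin.castAdd n i) = w (Fin.castAdd n (Fin.castSucc i)) := by
      intro i; simp only [Fin.init, he1]
    have hi2 : (fun j => Fin.init (fun i => w (e i)) (Fin.natAdd q j)) = fun j => w (Fin.natAdd (q + 1) j) := by
      ext j; simp only [Fin.init, he3]
    have hi3 : w (e (Fin.last (q + n))) = w (Fin.castAdd n (Fin.last q)) := by
      rw [he2]
    rw [hi2, hi3]
    simp only [hi1]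
    rw [Fin.forall_fin_succ']
    tauto
  have hr₂a : AnalyticOnNhd ℝ r₂.integrand r₂.domain := by
    intro w hw
    rw [hr₂, IntegralRep.reindex_integrand]
    set L : (Fin (q + 1 + n) → ℝ) →L[ℝ] (Fin (q + n + 1) → ℝ) :=
      ContinuousLinearMap.pi fun i => ContinuousLinearMap.proj (e i) with hL
    have hLw : ∀ w : Fin (q + 1 + n) → ℝ, L w = fun i => w (e i) := fun w => rfl
    have hmem : (fun i => w (e i)) ∈ r₁.domain := by
      rw [hr₂, IntegralRep.reindex_domain] at hw
      exact hw
    exact (hr₁a _ hmem).comp (L.analyticAt w)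
  -- induction hypothesis on `S'` at level `q + 1`, and transport back
  obtain ⟨c, hc, hr₂c⟩ := IH r₂ hr₂d hr₂a
  obtain ⟨c', hc', hcc'⟩ := span_transport e.symm c hc
  refine ⟨c', hc', ?_⟩
  have : of r - c' = -(of r₁ - of r) + (of r₁ - of r₂) + (of r₂ - c) + (c - c') := by abel
  rw [this]
  exact relations.add_mem (relations.add_mem (relations.add_mem (relations.neg_mem hr₁) hr₁₂) hr₂c) hcc'


/-- **The straightening step** (registered form: all hypotheses after the colon).  See
`straighten_step_of`. [cite: BochnakCosteRoy1998, Prop. 2.9.10] [cite: KontsevichZagier2001, §1.2 rule (2)] -/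
theorem straighten_step : ∀ {q n : ℕ} {S' : Set (Fin n → ℝ)}, IsOpen S' → IsSemialgebraic ℚ S' →
    ∀ {lo hi : (Fin n → ℝ) → ℝ}, AnalyticOnNhd ℝ lo S' → AnalyticOnNhd ℝ hi S' →
    IsSemialgebraicFunOn ℚ S' lo → IsSemialgebraicFunOn ℚ S' hi → (∀ x ∈ S', lo x < hi x) →
    (∀ {M : ℕ} {G : Set (Fin M → ℝ)}, IsOpen G → IsSemialgebraic ℚ G →
      ∀ {α β : (Fin M → ℝ) → ℝ}, IsSemialgebraicFunOn ℚ G α → IsSemialgebraicFunOn ℚ G β →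
      DifferentiableOn ℝ α G → DifferentiableOn ℝ β G → (∀ y ∈ G, 0 < β y) →
      ∀ r' : IntegralRep (M + 1),
        r'.domain = {z | (Fin.init z : Fin M → ℝ) ∈ G ∧ α (Fin.init z) < z (Fin.last M) ∧
          z (Fin.last M) < α (Fin.init z) + β (Fin.init z)} →
        ∃ r : IntegralRep (M + 1),
          r.domain = {z | (Fin.init z : Fin M → ℝ) ∈ G ∧ 0 < z (Fin.last M) ∧ z (Fin.last M) < 1} ∧
          (r.integrand = fun z => r'.integrand (Fin.snoc (Fin.init z)
            (α (Fin.init z) + β (Fin.init z) * z (Fin.last M))) * β (Fin.init z)) ∧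
          of r - of r' ∈ relations) →
    (∀ r : IntegralRep (q + 1 + n),
      r.domain = {z | (∀ i : Fin (q + 1), 0 < z (Fin.castAdd n i) ∧ z (Fin.castAdd n i) < 1) ∧
        (fun j => z (Fin.natAdd (q + 1) j)) ∈ S'} →
      AnalyticOnNhd ℝ r.integrand r.domain →
      ∃ c ∈ AddSubgroup.closure {d : FormalRep | ∃ v : IntegralRep (q + 1 + n),
          v.domain = {x : Fin (q + 1 + n) → ℝ | ∀ i, 0 < x i ∧ x i < 1} ∧
          AnalyticOnNhd ℝ v.integrand {x : Fin (q + 1 + n) → ℝ | ∀ i, 0 < x i ∧ x i < 1} ∧ d = of v},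
        of r - c ∈ relations) →
    ∀ r : IntegralRep (q + (n + 1)),
      r.domain = {z | (∀ i : Fin q, 0 < z (Fin.castAdd (n + 1) i) ∧ z (Fin.castAdd (n + 1) i) < 1) ∧
        (fun j => z (Fin.natAdd q j)) ∈ {w : Fin (n + 1) → ℝ | (Fin.init w : Fin n → ℝ) ∈ S' ∧
          lo (Fin.init w) < w (Fin.last n) ∧ w (Fin.last n) < hi (Fin.init w)}} →
      AnalyticOnNhd ℝ r.integrand r.domain →
      ∃ c ∈ AddSubgroup.closure {d : FormalRep | ∃ v : IntegralRep (q + (n + 1)),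
          v.domain = {x : Fin (q + (n + 1)) → ℝ | ∀ i, 0 < x i ∧ x i < 1} ∧
          AnalyticOnNhd ℝ v.integrand {x : Fin (q + (n + 1)) → ℝ | ∀ i, 0 < x i ∧ x i < 1} ∧ d = of v},
        of r - c ∈ relations :=
  fun hS'o hS's _ _ hlo_a hhi_a hlo_s hhi_s hlt hB IH r hdom han =>
    straighten_step_of hS'o hS's hlo_a hhi_a hlo_s hhi_s hlt hB IH r hdom han

end Summit.KontsevichZagierPeriods.FurushoPentagon.SectorToKernel
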